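import Summits.BirchSwinnertonDyer.BirchSwinnertonDyer.Theorems.SignedLowerHalvesSmallImageLowerHalfBothSignsRttRecipMTMatchUnits
import Mathlib.NumberTheory.Padics.RingHoms
import HarnessLib

/-!
# Route `SignedLowerHalves`, crux L `SmallImageLowerHalfBothSigns` (stmt-BirchSwinnertonDyer-23599), line `rtt_w3` v40 — row S4‴ (`stub_junctionRecipValues_ns`), THE MATCH,
# bookkeeping III: the `p`-ADIC discrete logarithm (a compatible system `ℓ_n(N) ∈ ℤ/pⁿ` IS an element of `ℤ_p`) and uniqueness of the character of `Γ_n` with given `χ(γ)`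

WIDTH seat `bsd-line-slh-p3-w3` g29 under LEAD `cruxlead-stmt-BirchSwinnertonDyer-23599` g15 (cell `bsd-ssimc`). Helper `--supports stmt-BirchSwinnertonDyer-23599`. THEOREMS ONLY.

WHY. In `hval` the unit `U ∈ Λ_{𝒪_S}ˣ` is FIXED while its values `u_n(ζ − 1)` must reproduce, for every level `n`, character values `χ(N) = χ(γ)^{ℓ_n(N)}` (`N = N𝔞`, the
level `M`, the frame incoherence `b` of the root system): `U ∋ (1+X)^{L}` with a `p`-adic exponent `L ∈ ℤ_p` reducing to `ℓ_n(N) mod pⁿ` for all `n` (then honda's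
`exists_unit_sub_mul_onePlusXPow` / `exists_binomialSeries_sub_pow_eq` supply the polynomial representatives). This file proves that such an `L` exists for every
compatible system (`PadicInt.lift` on `ℤ[X]`) — ★ `exists_padicInt_toZModPow_eq` — and in particular for the discrete logarithms `gammaLog p n` of a fixed unit
(★ `exists_padicInt_toZModPow_eq_gammaLog_natCast`, compatibility `gammaLog_castHom_classMap`); and that an even `p`-power-order character modulo `p^{n+e₀}` is determined
by its value at `γ = cyclotomicGenerator p` (★ `dirichletCharacter_eq_of_apply_cyclotomicGenerator_eq`, from honda's dictionary `apply_eq_apply_cyclotomicGenerator_pow_gammaLog`).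
HONEST FRAMING: elementary; nothing about S4‴ itself; S4‴, crux L and BSD remain OPEN. References: [Washington1997] §7.2; [MazurTateTeitelbaum1986Invent] §I.13.
-/

set_option autoImplicit false
set_option linter.dupNamespace false -- D-0017: single-problem summit, the namespace repeats the problem name by design
noncomputable section

open scoped Classical
open Polynomial Literature.NumberTheory.EllipticCurves

namespace Summit.BirchSwinnertonDyer.BirchSwinnertonDyer.Theorems.SmallImageRttReciprocity

variable {p : ℕ} [Fact p.Prime]

/-! ## §1 Compatible systems in `ℤ/pⁿ` are `p`-adic integers -/

/-- ★ **A compatible system `x_n ∈ ℤ/pⁿ` (`x_{n} ↦ x_{m}` under reduction, `m ≤ n`) is the reduction of ONE `p`-adic integer**: `∃ L ∈ ℤ_p, L mod pⁿ = x_n` for all `n`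
(`PadicInt.lift` applied to the evaluations `ℤ[X] → ℤ/pⁿ`, `X ↦ x_n`). [cite: Washington1997, §7.2] -/
theorem exists_padicInt_toZModPow_eq (x : ∀ n : ℕ, ZMod (p ^ n))
    (hx : ∀ (m n : ℕ) (h : m ≤ n), ZMod.castHom (pow_dvd_pow p h) (ZMod (p ^ m)) (x n) = x m) :
    ∃ L : ℤ_[p], ∀ n : ℕ, PadicInt.toZModPow n L = x n := by
  let f : ∀ k : ℕ, ℤ[X] →+* ZMod (p ^ k) := fun k ↦ Polynomial.eval₂RingHom (Int.castRingHom _) (x k)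
  have hf : ∀ (k1 k2 : ℕ) (hk : k1 ≤ k2), (ZMod.castHom (pow_dvd_pow p hk) (ZMod (p ^ k1))).comp (f k2) = f k1 := fun k1 k2 hk ↦ by
    refine Polynomial.ringHom_ext (fun z ↦ ?_) ?_
    · simp only [f, eq_intCast, map_intCast]
    · simp only [f, RingHom.comp_apply, Polynomial.coe_eval₂RingHom, Polynomial.eval₂_X, hx k1 k2 hk]
  refine ⟨PadicInt.lift hf X, fun n ↦ ?_⟩
  have h := congrArg (fun g : ℤ[X] →+* ZMod (p ^ n) ↦ g X) (PadicInt.lift_spec hf n)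
  simpa only [f, RingHom.comp_apply, Polynomial.coe_eval₂RingHom, Polynomial.eval₂_X] using h

/-- **Reduction of levels reduces the discrete logarithm** for a general unit `u` mod `p^{n+e₀}` (`gammaLog_castHom_classMap` after writing `u = η γˢ`).
[cite: Washington1997, §7.2] -/
theorem castHom_gammaLog_eq {m n : ℕ} (h : m ≤ n) {u : ZMod (p ^ (n + cyclotomicExponent p))} (hu : IsUnit u) :
    ZMod.castHom (pow_dvd_pow p h) (ZMod (p ^ m)) (gammaLog p n u) =
      gammaLog p m (ZMod.castHom (pow_dvd_pow p (Nat.add_le_add_right h (cyclotomicExponent p))) (ZMod (p ^ (m + cyclotomicExponent p))) u) := by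
  obtain ⟨η, s, rfl⟩ := exists_classMap_eq_of_isUnit p n hu
  rw [gammaLog_classMap, gammaLog_castHom_classMap p h, ZMod.castHom_apply, ZMod.natCast_val]

/-- ★ **The `p`-adic discrete logarithm of a unit**: for `N` prime to `p` there is `L ∈ ℤ_p` with `L mod pⁿ = ℓ_n(N mod p^{n+e₀})` for every `n`
(`ℓ_n = gammaLog p n`; i.e. `⟨N⟩ = γ^L` in `1 + p^{e₀}ℤ_p`). [cite: Washington1997, §7.2] [cite: MazurTateTeitelbaum1986Invent, §I.13] -/
theorem exists_padicInt_toZModPow_eq_gammaLog_natCast {N : ℕ} (hN : N.Coprime p) :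
    ∃ L : ℤ_[p], ∀ n : ℕ, PadicInt.toZModPow n L = gammaLog p n (N : ZMod (p ^ (n + cyclotomicExponent p))) := by
  refine exists_padicInt_toZModPow_eq (fun n ↦ gammaLog p n (N : ZMod (p ^ (n + cyclotomicExponent p)))) fun m n h ↦ ?_
  have hu : IsUnit (N : ZMod (p ^ (n + cyclotomicExponent p))) := by
    rw [ZMod.isUnit_iff_coprime]
    exact Nat.Coprime.pow_right _ hN
  rw [castHom_gammaLog_eq h hu, map_natCast]

/-! ## §2 A character of `Γ_n` is determined by `χ(γ)` -/

/-- ★ **Two even `p`-power-order characters modulo `p^{n+e₀}` with the same value at `γ = cyclotomicGenerator p` are equal** (both are `u ↦ χ(γ)^{ℓ_n(u)}` on units).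
[cite: Washington1997, §7.2] [cite: MazurTateTeitelbaum1986Invent, §I.13] -/
theorem dirichletCharacter_eq_of_apply_cyclotomicGenerator_eq {R : Type*} [CommRing R] {n : ℕ} {χ₁ χ₂ : DirichletCharacter R (p ^ (n + cyclotomicExponent p))}
    (h₁ : χ₁.Even) (ho₁ : ∃ j : ℕ, orderOf χ₁ = p ^ j) (h₂ : χ₂.Even) (ho₂ : ∃ j : ℕ, orderOf χ₂ = p ^ j)
    (h : χ₁ (cyclotomicGenerator p : ZMod (p ^ (n + cyclotomicExponent p))) = χ₂ (cyclotomicGenerator p : ZMod (p ^ (n + cyclotomicExponent p)))) :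
    χ₁ = χ₂ := by
  refine MulChar.ext fun u ↦ ?_
  rw [apply_eq_apply_cyclotomicGenerator_pow_gammaLog χ₁ h₁ ho₁ u.isUnit, apply_eq_apply_cyclotomicGenerator_pow_gammaLog χ₂ h₂ ho₂ u.isUnit, h]

/-- **Transport of a character along a ring homomorphism keeps evenness and the order a `p`-power** (e.g. along a field isomorphism `e : ℚ̄_p ≃ ℂ`).
[cite: Washington1997, §7.2] -/
theorem ringHomComp_even_and_orderOf {R R' : Type*} [CommRing R] [CommRing R'] {m : ℕ} (χ : DirichletCharacter R m) (f : R →+* R')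
    (heven : χ.Even) (hord : ∃ j : ℕ, orderOf χ = p ^ j) :
    DirichletCharacter.Even (χ.ringHomComp f) ∧ ∃ j : ℕ, orderOf (χ.ringHomComp f) = p ^ j := by
  have hp : p.Prime := Fact.out
  refine ⟨?_, ?_⟩
  · show (χ.ringHomComp f) (-1) = 1
    rw [MulChar.ringHomComp_apply, heven, map_one]
  · obtain ⟨j, hj⟩ := hord
    have h1 : χ.ringHomComp f ^ p ^ j = 1 := MulChar.ext fun u ↦ by
      rw [MulChar.pow_apply_coe, MulChar.ringHomComp_apply, ← map_pow, ← MulChar.pow_apply_coe, ← hj, pow_orderOf_eq_one,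
        MulChar.one_apply_coe, MulChar.one_apply_coe, map_one]
    obtain ⟨i, -, hi⟩ := (Nat.dvd_prime_pow hp).mp (orderOf_dvd_of_pow_eq_one h1)
    exact ⟨i, hi⟩

end Summit.BirchSwinnertonDyer.BirchSwinnertonDyer.Theorems.SmallImageRttReciprocity

end
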